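import Literature.MathematicalPhysics.QuantumManyBody.TorusFockLayer
import Literature.MathematicalPhysics.QuantumManyBody.DyadicCoherentFractionRefinement

/-!
# Bilinearity glue for `BlockCoherenceToPeriodicBEC` (stmt-AtomisticToContinuum-14494, helpers)

Helper file (`--supports` stmt-14494) for the support item `BECPopovBerryRG.BlockCoherenceToPeriodicBEC`
of route `BECPopovBerryRG` (`BlockPhaseCoherence → PeriodicBEC(v)`), proved in
`Theorems/BECPopovBerryRGBlockCoherenceToPeriodicBEC.lean`. The item is pure bilinearity of the
occupation form `φ ↦ ⟨φ, γ_Ψ φ⟩ = N ∫_{Ω^{N-1}} |∫_Ω conj(φ) Ψ|²` in the mode; this file proves the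
mode-independent core:

* for a finite family of pairwise disjoint measurable blocks `B_i` tiling the fundamental cell
  `Ω = [0,L)³`, with flat modes `φ_i = (s³)^{-1/2} 1_{B_i}` and block amplitudes
  `J_i(Y) = ∫_{B_i} Ψ(x, Y) dx`, one has `∫_Ω conj(φ_i) Ψ(·,Y) = (s³)^{-1/2} J_i(Y)`,
  `∫_Ω conj(φ_i + φ_j) Ψ(·,Y) = (s³)^{-1/2}(J_i + J_j)(Y)` and `∫_Ω Ψ(·,Y) = Σ_i J_i(Y)`;
* summing a pairwise hypothesis `occ(φ_i) + occ(φ_j) + C ≤ occ(φ_i + φ_j)` over all `(i, j)` and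
  using the polarisation bookkeeping `Σ_{i,j} |b_i + b_j|² = 2M Σ_i |b_i|² + 2 |Σ_i b_i|²`
  (`M` = number of blocks) gives `2M Σ_i occ(φ_i) + M² C ≤ 2M Σ_i occ(φ_i) + 2 (s³)⁻¹ L³ · n₀`,
  where `n₀ = condensateOccupation`; the single-block occupations are finite (Cauchy–Schwarz on
  the block, Tonelli over the first particle, `∫_{Ω^N}|Ψ|² = 1`), so they cancel, and with
  `s³ M = L³` one gets `M · C ≤ 2 n₀` (`card_mul_le_two_mul_condensateOccupation`).

No near-minimiser property, positivity or reality of `Ψ` is used beyond `C¹` + normalisation.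

References: S. Fournais, *Length scales for BEC in the dilute Bose gas* (2020), (1.3)–(1.5)
(`n₀ = Σ_j P_{Ω,j}`); E. H. Lieb, R. Seiringer, J. P. Solovej, J. Yngvason, *The Mathematics of the
Bose Gas and its Condensation* (2005), §1.2 (1.17). Tree: `cellOccupation_succ`,
`condensateOccupation_succ`, `lintegral_cellN_succ`, `integrableOn_cell_conj_mul`,
`nnnorm_integral_sq_le_mul_lintegral`, `measurable_setIntegral_vecCons`.
-/

noncomputable section

open MeasureTheory Filter
open scoped ENNReal NNReal ComplexConjugate

namespace Summit.AtomisticToContinuum.BoseEinsteinCondensation.Theorems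

open Literature.MathematicalPhysics.QuantumManyBody.BoseGas

namespace BlockCoherenceGlue

/-! ## Polarisation bookkeeping -/

section Algebra

/-- `|Σ_i b_i|² = Σ_i Σ_j Re(b_i conj b_j)`. [folklore] -/
theorem normSq_sum_eq {ι : Type*} (s : Finset ι) (b : ι → ℂ) :
    Complex.normSq (∑ i ∈ s, b i) = ∑ i ∈ s, ∑ j ∈ s, (b i * conj (b j)).re := by
  have h := Complex.mul_conj (∑ i ∈ s, b i)
  rw [map_sum, Finset.sum_mul_sum] at h
  have h' := congrArg Complex.re h
  rw [Complex.ofReal_re, Complex.re_sum] at h'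
  rw [← h']
  refine Finset.sum_congr rfl fun i _ => ?_
  rw [Complex.re_sum]

/-- **Polarisation bookkeeping**: `Σ_i Σ_j |b_i + b_j|² = 2 |s| Σ_i |b_i|² + 2 |Σ_i b_i|²`. [folklore] -/
theorem sum_sum_normSq_add {ι : Type*} (s : Finset ι) (b : ι → ℂ) :
    ∑ i ∈ s, ∑ j ∈ s, Complex.normSq (b i + b j) =
      2 * s.card * ∑ i ∈ s, Complex.normSq (b i) + 2 * Complex.normSq (∑ i ∈ s, b i) := by
  have h1 : ∀ i ∈ s, ∑ j ∈ s, Complex.normSq (b i + b j) =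
      s.card * Complex.normSq (b i) + ∑ j ∈ s, Complex.normSq (b j) +
        2 * ∑ j ∈ s, (b i * conj (b j)).re := by
    intro i _
    simp_rw [Complex.normSq_add, Finset.sum_add_distrib, Finset.sum_const, nsmul_eq_mul,
      ← Finset.mul_sum]
  rw [Finset.sum_congr rfl h1, Finset.sum_add_distrib, Finset.sum_add_distrib, Finset.sum_const,
    nsmul_eq_mul, ← Finset.mul_sum, ← Finset.mul_sum, normSq_sum_eq]
  ring

/-- The same in `ℝ≥0∞` with `‖·‖₊²`:
`Σ_i Σ_j ‖b_i + b_j‖₊² = 2 |ι| Σ_i ‖b_i‖₊² + 2 ‖Σ_i b_i‖₊²`. [folklore] -/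
theorem sum_sum_nnnorm_add_sq {ι : Type*} [Fintype ι] (b : ι → ℂ) :
    ∑ i, ∑ j, ((‖b i + b j‖₊ : ℝ≥0∞) ^ 2) =
      2 * (Fintype.card ι : ℝ≥0∞) * ∑ i, ((‖b i‖₊ : ℝ≥0∞) ^ 2) +
        2 * (‖∑ i, b i‖₊ : ℝ≥0∞) ^ 2 := by
  simp only [nnnorm_coe_sq_eq_ofReal, Complex.sq_norm]
  have h1 : ∀ i, ∑ j, ENNReal.ofReal (Complex.normSq (b i + b j)) =
      ENNReal.ofReal (∑ j, Complex.normSq (b i + b j)) := fun i =>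
    (ENNReal.ofReal_sum_of_nonneg fun j _ => Complex.normSq_nonneg _).symm
  simp only [h1]
  rw [← ENNReal.ofReal_sum_of_nonneg fun i _ => Finset.sum_nonneg fun j _ => Complex.normSq_nonneg _,
    ← ENNReal.ofReal_sum_of_nonneg fun i _ => Complex.normSq_nonneg _, sum_sum_normSq_add,
    Finset.card_univ,
    ENNReal.ofReal_add (mul_nonneg (by positivity) (Finset.sum_nonneg fun i _ => Complex.normSq_nonneg _))
      (mul_nonneg zero_le_two (Complex.normSq_nonneg _)),
    ENNReal.ofReal_mul (by positivity), ENNReal.ofReal_mul zero_le_two,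
    ENNReal.ofReal_mul zero_le_two, ENNReal.ofReal_ofNat, ENNReal.ofReal_natCast]

end Algebra

/-! ## Flat modes of blocks against slices -/

section Slices

variable {n : ℕ} {L : ℝ}

/-- The pairing of the flat mode `r⁻¹ 1_B` (`B ⊆ Ω` measurable) with a one-particle function on
the cell: `∫_Ω conj(r⁻¹ 1_B) f = r⁻¹ ∫_B f`. [folklore] -/
theorem setIntegral_conj_indicator_mul {B : Set Space} (hB : MeasurableSet B) (hBsub : B ⊆ cell L)
    (r : ℝ) (f : Space → ℂ) :
    ∫ x in cell L, conj (B.indicator (fun _ => ((r : ℂ))⁻¹) x) * f x =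
      ((r : ℂ))⁻¹ * ∫ x in B, f x := by
  have h : ∀ x, conj (B.indicator (fun _ => ((r : ℂ))⁻¹) x) * f x =
      B.indicator (fun x => ((r : ℂ))⁻¹ * f x) x := by
    intro x
    by_cases hx : x ∈ B
    · rw [Set.indicator_of_mem hx, Set.indicator_of_mem hx, map_inv₀, Complex.conj_ofReal]
    · rw [Set.indicator_of_notMem hx, Set.indicator_of_notMem hx, map_zero, zero_mul]
  simp_rw [h]
  rw [setIntegral_indicator hB, Set.inter_eq_self_of_subset_right hBsub, integral_const_mul]

/-- `∫_Ω f = Σ_i ∫_{B_i} f` for a finite measurable partition `(B_i)` of the cell and `f`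
integrable on the cell. [folklore] -/
-- adapted from Theorems/BECStronglyRayleighLatticeToPeriodicBridgeCellPairSumRule.lean
theorem setIntegral_cell_eq_sum_of_cover {ι : Type*} [Fintype ι] {B : ι → Set Space}
    (hBm : ∀ i, MeasurableSet (B i)) (hdisj : Pairwise (Function.onFun Disjoint B))
    (hcov : cell L = ⋃ i, B i) {f : Space → ℂ} (hf : IntegrableOn f (cell L) volume) :
    ∫ x in cell L, f x = ∑ i, ∫ x in B i, f x := by
  have hsub : ∀ i, IntegrableOn f (B i) volume := fun i =>
    hf.mono_set (hcov ▸ Set.subset_iUnion B i)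
  rw [hcov]
  exact integral_iUnion_fintype hBm hdisj hsub

/-- **Finiteness of single-block occupations.** For a periodic trial state and the flat mode
`a 1_B` of a measurable `B ⊆ Ω`, `∫_{Ω^n} ‖a ∫_B Ψ(x,Y) dx‖² dY ≤ ‖a‖² |Ω| < ∞`
(Cauchy–Schwarz on `B`, Tonelli over the first particle, `∫_{Ω^{n+1}}|Ψ|² = 1`). [folklore] -/
theorem lintegral_block_amplitude_ne_top {B : Set Space} (hBsub : B ⊆ cell L)
    (a : ℂ) (Ψ : PeriodicTrialState (n + 1) L) :
    ∫⁻ Y in cellN n L, ((‖a * ∫ x in B, Ψ.ψ (Matrix.vecCons x Y)‖₊ : ℝ≥0∞) ^ 2) ≠ ⊤ := by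
  have hcont : Continuous Ψ.ψ := Ψ.contDiff.continuous
  have hF : Measurable fun X : Config (n + 1) => ((‖Ψ.ψ X‖₊ : ℝ≥0∞) ^ 2) :=
    (hcont.measurable.nnnorm.coe_nnreal_ennreal).pow_const 2
  have hslice : ∀ Y : Config n, Measurable fun x : Space => Ψ.ψ (Matrix.vecCons x Y) := fun Y =>
    (hcont.comp (continuous_id.matrixVecCons continuous_const)).measurable
  have hvol : volume (cell L) = ENNReal.ofReal L ^ 3 := volume_cell L
  -- pointwise Cauchy–Schwarz
  have hpt : ∀ Y : Config n, ((‖a * ∫ x in B, Ψ.ψ (Matrix.vecCons x Y)‖₊ : ℝ≥0∞) ^ 2) ≤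
      ((‖a‖₊ : ℝ≥0∞) ^ 2 * volume (cell L)) *
        ∫⁻ x in cell L, ((‖Ψ.ψ (Matrix.vecCons x Y)‖₊ : ℝ≥0∞) ^ 2) := by
    intro Y
    rw [nnnorm_mul, ENNReal.coe_mul, mul_pow, mul_assoc]
    gcongr
    calc ((‖∫ x in B, Ψ.ψ (Matrix.vecCons x Y)‖₊ : ℝ≥0∞) ^ 2)
        ≤ volume B * ∫⁻ x in B, ((‖Ψ.ψ (Matrix.vecCons x Y)‖₊ : ℝ≥0∞) ^ 2) := by
          simpa only [Measure.restrict_apply_univ] using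
            nnnorm_integral_sq_le_mul_lintegral (volume.restrict B) (hslice Y).aemeasurable
      _ ≤ volume (cell L) * ∫⁻ x in cell L, ((‖Ψ.ψ (Matrix.vecCons x Y)‖₊ : ℝ≥0∞) ^ 2) :=
          mul_le_mul' (measure_mono hBsub) (lintegral_mono_set hBsub)
  refine ne_top_of_le_ne_top ?_ (lintegral_mono hpt)
  rw [lintegral_const_mul' _ _ (ENNReal.mul_ne_top (ENNReal.pow_ne_top ENNReal.coe_ne_top)
    (by rw [hvol]; exact ENNReal.pow_ne_top ENNReal.ofReal_ne_top)),
    ← lintegral_cellN_succ L hF, Ψ.norm_eq, mul_one]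
  exact ENNReal.mul_ne_top (ENNReal.pow_ne_top ENNReal.coe_ne_top)
    (by rw [hvol]; exact ENNReal.pow_ne_top ENNReal.ofReal_ne_top)

end Slices

/-! ## The core: pairwise block coherence bounds the condensate occupation -/

section Core

variable {n : ℕ} {L s : ℝ}

/-- **Bilinearity glue.** Let `(B_i)_{i ∈ ι}` be finitely many pairwise disjoint measurable sets
tiling the fundamental cell `Ω = [0,L)³`, `s > 0` with `s³ |ι| = L³`, `φ_i = (s³)^{-1/2} 1_{B_i}`
the flat modes, and `Ψ` a periodic `(n+1)`-body trial state with
`occ(φ_i) + occ(φ_j) + C ≤ occ(φ_i + φ_j)` for all `i, j` (occupations on the cell). Then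
`|ι| · C ≤ 2 ⟨Ψ, n₀ Ψ⟩`. [folklore] -/
theorem card_mul_le_two_mul_condensateOccupation {ι : Type*} [Fintype ι] (hL : 0 < L)
    (hs : 0 < s) {B : ι → Set Space} (hBm : ∀ i, MeasurableSet (B i))
    (hdisj : Pairwise (Function.onFun Disjoint B)) (hcov : cell L = ⋃ i, B i)
    (hcard : s ^ 3 * Fintype.card ι = L ^ 3) (Ψ : PeriodicTrialState (n + 1) L) {C : ℝ≥0∞}
    (hpair : ∀ i j,
      cellOccupation (n + 1) L ((B i).indicator fun _ => ((Real.sqrt (s ^ 3) : ℂ))⁻¹) Ψ.ψ +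
        cellOccupation (n + 1) L ((B j).indicator fun _ => ((Real.sqrt (s ^ 3) : ℂ))⁻¹) Ψ.ψ +
          C ≤
      cellOccupation (n + 1) L (fun x => (B i).indicator (fun _ => ((Real.sqrt (s ^ 3) : ℂ))⁻¹) x +
        (B j).indicator (fun _ => ((Real.sqrt (s ^ 3) : ℂ))⁻¹) x) Ψ.ψ) :
    (Fintype.card ι : ℝ≥0∞) * C ≤ 2 * condensateOccupation (n + 1) L Ψ.ψ := by
  classical
  set a : ℂ := ((Real.sqrt (s ^ 3) : ℂ))⁻¹ with ha
  set M : ℕ := Fintype.card ι with hM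
  have hBsub : ∀ i, B i ⊆ cell L := fun i => hcov ▸ Set.subset_iUnion B i
  have hcont : Continuous Ψ.ψ := Ψ.contDiff.continuous
  have hmeasΨ : Measurable Ψ.ψ := hcont.measurable
  have hslice : ∀ Y : Config n, Continuous fun x : Space => Ψ.ψ (Matrix.vecCons x Y) := fun Y =>
    hcont.comp (continuous_id.matrixVecCons continuous_const)
  -- block amplitudes
  set J : ι → Config n → ℂ := fun i Y => ∫ x in B i, Ψ.ψ (Matrix.vecCons x Y) with hJ
  have hJm : ∀ i, Measurable (J i) := fun i => measurable_setIntegral_vecCons hmeasΨ (B i)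
  -- Step 1: inner products of the flat modes with the slices
  have hmode_meas : ∀ i, Measurable ((B i).indicator fun _ : Space => a) := fun i =>
    measurable_const.indicator (hBm i)
  have hmode_bdd : ∀ i (x : Space), ‖(B i).indicator (fun _ : Space => a) x‖ ≤ ‖a‖ := fun i x =>
    norm_indicator_le_norm_self _ _
  have hint : ∀ i (Y : Config n), IntegrableOn
      (fun x => conj ((B i).indicator (fun _ => a) x) * Ψ.ψ (Matrix.vecCons x Y)) (cell L) volume :=
    fun i Y => integrableOn_cell_conj_mul (hmode_meas i) (hmode_bdd i) (hslice Y)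
  have hI1 : ∀ i (Y : Config n),
      ∫ x in cell L, conj ((B i).indicator (fun _ => a) x) * Ψ.ψ (Matrix.vecCons x Y) =
        a * J i Y :=
    fun i Y => setIntegral_conj_indicator_mul (hBm i) (hBsub i) _ _
  have hI2 : ∀ i j (Y : Config n),
      ∫ x in cell L, conj ((B i).indicator (fun _ => a) x + (B j).indicator (fun _ => a) x) *
          Ψ.ψ (Matrix.vecCons x Y) = a * J i Y + a * J j Y := by
    intro i j Y
    simp_rw [map_add, add_mul]
    rw [integral_add (hint i Y) (hint j Y), hI1, hI1]
  -- Step 2: occupations through the amplitudes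
  set X : ι → ℝ≥0∞ := fun i => ∫⁻ Y in cellN n L, ((‖a * J i Y‖₊ : ℝ≥0∞) ^ 2) with hX
  have hocc1 : ∀ i, cellOccupation (n + 1) L ((B i).indicator fun _ => a) Ψ.ψ =
      (n + 1 : ℝ≥0∞) * X i := by
    intro i
    rw [cellOccupation_succ]
    simp_rw [hI1]
    rfl
  have hocc2 : ∀ i j, cellOccupation (n + 1) L
      (fun x => (B i).indicator (fun _ => a) x + (B j).indicator (fun _ => a) x) Ψ.ψ =
      (n + 1 : ℝ≥0∞) * ∫⁻ Y in cellN n L, ((‖a * J i Y + a * J j Y‖₊ : ℝ≥0∞) ^ 2) := by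
    intro i j
    rw [cellOccupation_succ]
    simp_rw [hI2]
  set I : ℝ≥0∞ := ∫⁻ Y in cellN n L, ((‖∑ i, J i Y‖₊ : ℝ≥0∞) ^ 2) with hI
  have hcond : condensateOccupation (n + 1) L Ψ.ψ =
      (n + 1 : ℝ≥0∞) * ((ENNReal.ofReal L ^ 3)⁻¹ * I) := by
    rw [condensateOccupation_succ hL]
    congr 2
    refine lintegral_congr fun Y => ?_
    rw [setIntegral_cell_eq_sum_of_cover hBm hdisj hcov (integrableOn_cell (hslice Y))]
  -- Step 3: measurability and finiteness
  have hmeas1 : ∀ i, Measurable fun Y => ((‖a * J i Y‖₊ : ℝ≥0∞) ^ 2) := fun i =>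
    (((hJm i).const_mul a).nnnorm.coe_nnreal_ennreal).pow_const 2
  have hmeas2 : ∀ i j, Measurable fun Y => ((‖a * J i Y + a * J j Y‖₊ : ℝ≥0∞) ^ 2) := fun i j =>
    ((((hJm i).const_mul a).add ((hJm j).const_mul a)).nnnorm.coe_nnreal_ennreal).pow_const 2
  have hmeasS : Measurable fun Y => ((‖a * ∑ i, J i Y‖₊ : ℝ≥0∞) ^ 2) :=
    (((Finset.measurable_sum Finset.univ fun i _ => hJm i).const_mul a)
      |>.nnnorm.coe_nnreal_ennreal).pow_const 2
  have hXfin : ∀ i, X i ≠ ⊤ := fun i => lintegral_block_amplitude_ne_top (hBsub i) a Ψ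
  -- Step 4: sum the pairwise inequalities over all pairs
  have hsum : ∑ i, ∑ j, ((n + 1 : ℝ≥0∞) * X i + (n + 1 : ℝ≥0∞) * X j + C) ≤
      ∑ i, ∑ j, (n + 1 : ℝ≥0∞) *
        ∫⁻ Y in cellN n L, ((‖a * J i Y + a * J j Y‖₊ : ℝ≥0∞) ^ 2) :=
    Finset.sum_le_sum fun i _ => Finset.sum_le_sum fun j _ => by
      simpa only [hocc1, hocc2] using hpair i j
  have hlhs : ∑ i, ∑ j, ((n + 1 : ℝ≥0∞) * X i + (n + 1 : ℝ≥0∞) * X j + C) =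
      2 * (M : ℝ≥0∞) * ((n + 1 : ℝ≥0∞) * ∑ i, X i) + (M : ℝ≥0∞) * ((M : ℝ≥0∞) * C) := by
    simp only [Finset.sum_add_distrib, Finset.sum_const, Finset.card_univ, nsmul_eq_mul,
      ← Finset.mul_sum, hM]
    ring
  have hrhs : ∑ i, ∑ j, (n + 1 : ℝ≥0∞) *
        ∫⁻ Y in cellN n L, ((‖a * J i Y + a * J j Y‖₊ : ℝ≥0∞) ^ 2) =
      2 * (M : ℝ≥0∞) * ((n + 1 : ℝ≥0∞) * ∑ i, X i) +
        2 * ((n + 1 : ℝ≥0∞) * ∫⁻ Y in cellN n L, ((‖a * ∑ i, J i Y‖₊ : ℝ≥0∞) ^ 2)) := by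
    have h1 : ∀ i, ∑ j, ∫⁻ Y in cellN n L, ((‖a * J i Y + a * J j Y‖₊ : ℝ≥0∞) ^ 2) =
        ∫⁻ Y in cellN n L, ∑ j, ((‖a * J i Y + a * J j Y‖₊ : ℝ≥0∞) ^ 2) := fun i =>
      (lintegral_finsetSum Finset.univ fun j _ => hmeas2 i j).symm
    have h2 : ∑ i, ∫⁻ Y in cellN n L, ∑ j, ((‖a * J i Y + a * J j Y‖₊ : ℝ≥0∞) ^ 2) =
        ∫⁻ Y in cellN n L, ∑ i, ∑ j, ((‖a * J i Y + a * J j Y‖₊ : ℝ≥0∞) ^ 2) :=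
      (lintegral_finsetSum Finset.univ fun i _ =>
        Finset.measurable_sum Finset.univ fun j _ => hmeas2 i j).symm
    have h3 : ∀ Y : Config n, ∑ i, ∑ j, ((‖a * J i Y + a * J j Y‖₊ : ℝ≥0∞) ^ 2) =
        2 * (M : ℝ≥0∞) * ∑ i, ((‖a * J i Y‖₊ : ℝ≥0∞) ^ 2) +
          2 * ((‖a * ∑ i, J i Y‖₊ : ℝ≥0∞) ^ 2) := by
      intro Y
      rw [sum_sum_nnnorm_add_sq (fun i => a * J i Y), ← Finset.mul_sum]
    have h4 : ∑ i, X i = ∫⁻ Y in cellN n L, ∑ i, ((‖a * J i Y‖₊ : ℝ≥0∞) ^ 2) :=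
      (lintegral_finsetSum Finset.univ fun i _ => hmeas1 i).symm
    simp_rw [← Finset.mul_sum, h1, h2, h3]
    rw [lintegral_add_left ((Finset.measurable_sum Finset.univ fun i _ => hmeas1 i).const_mul _),
      lintegral_const_mul _ (Finset.measurable_sum Finset.univ fun i _ => hmeas1 i),
      lintegral_const_mul _ hmeasS, h4]
    ring
  -- Step 5: cancel the (finite) single-block occupations
  have hfinS : 2 * (M : ℝ≥0∞) * ((n + 1 : ℝ≥0∞) * ∑ i, X i) ≠ ⊤ := by
    refine ENNReal.mul_ne_top (ENNReal.mul_ne_top ENNReal.ofNat_ne_top (ENNReal.natCast_ne_top _))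
      (ENNReal.mul_ne_top ?_ (ENNReal.sum_ne_top.2 fun i _ => hXfin i))
    exact_mod_cast ENNReal.natCast_ne_top (n + 1)
  have hkey : (M : ℝ≥0∞) * ((M : ℝ≥0∞) * C) ≤
      2 * ((n + 1 : ℝ≥0∞) * ∫⁻ Y in cellN n L, ((‖a * ∑ i, J i Y‖₊ : ℝ≥0∞) ^ 2)) := by
    rw [hlhs, hrhs] at hsum
    exact (ENNReal.add_le_add_iff_left hfinS).1 hsum
  -- Step 6: identify the right-hand side with `2 M · n₀`
  rcases Nat.eq_zero_or_pos M with hM0 | hMpos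
  · simp [hM0]
  have hMR : (0 : ℝ) < M := by exact_mod_cast hMpos
  have hL3 : 0 < L ^ 3 := by positivity
  have hamp : ∀ Y : Config n, ((‖a * ∑ i, J i Y‖₊ : ℝ≥0∞) ^ 2) =
      ENNReal.ofReal ((s ^ 3)⁻¹) * ((‖∑ i, J i Y‖₊ : ℝ≥0∞) ^ 2) := by
    intro Y
    rw [nnnorm_mul, ENNReal.coe_mul, mul_pow, ha, nnnorm_flatAmp_sq hs]
  have hratio : ENNReal.ofReal ((s ^ 3)⁻¹) = (M : ℝ≥0∞) * (ENNReal.ofReal L ^ 3)⁻¹ := by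
    have hs3 : s ^ 3 = L ^ 3 / M := by
      rw [eq_div_iff hMR.ne']
      exact hcard
    rw [hs3, inv_div, div_eq_mul_inv, ENNReal.ofReal_mul (Nat.cast_nonneg _), ENNReal.ofReal_natCast,
      ENNReal.ofReal_inv_of_pos hL3, ENNReal.ofReal_pow hL.le]
  have hfinal : 2 * ((n + 1 : ℝ≥0∞) * ∫⁻ Y in cellN n L, ((‖a * ∑ i, J i Y‖₊ : ℝ≥0∞) ^ 2)) =
      (M : ℝ≥0∞) * (2 * condensateOccupation (n + 1) L Ψ.ψ) := by
    simp_rw [hamp]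
    rw [lintegral_const_mul' _ _ ENNReal.ofReal_ne_top, hratio, hcond]
    ring
  rw [hfinal] at hkey
  exact (ENNReal.mul_le_mul_iff_right (by exact_mod_cast hMpos.ne') (ENNReal.natCast_ne_top _)).1 hkey

end Core

end BlockCoherenceGlue

end Summit.AtomisticToContinuum.BoseEinsteinCondensation.Theorems

end
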